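import Mathlib

/-!
# `DivisionGap.PerCofactorDegreeReduction` (stmt-ValiantsHypothesis-15046), line `Sketch_ideator4`:
from the closed-form rung to the window currency (stub `stub_windowOfRung`, O)

The class rungs of the line end in the closed form
`⌊n/3⌋ · (2^(⌊n/3⌋ - 1) - 1) ≤ 2 · ((n + 2) · (s + 3))^k`; the core stub consumes hardness in the
window currency `n ≤ (log₂ n + log₂ s + c)^c`.  This file converts the former into the latter,
once and for all `k`, with the explicit witnesses `c := 3k + 3`, `n₀ := 6`.

Proof.  Write `L := log₂ n`, `S := log₂ s`, `q := ⌊n/3⌋ ≥ 2`.  Since `n < 2^(L+1)` and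
`s < 2^(S+1)` we have `n + 2 ≤ 2^(L+2)` and `s + 3 ≤ 2^(S+2)`, so the hypothesis gives
`2^(q-1) - 1 ≤ q · (2^(q-1) - 1) ≤ 2 · 2^((L+S+4)k)`, hence `2^(q-1) < 2^((L+S+4)k + 2)`, i.e.
`q ≤ (L+S+4)k + 2` and `n ≤ 3q + 2 ≤ 3(L+S+4)k + 8 ≤ (L+S+3k+3)^2 ≤ (L+S+3k+3)^(3k+3)`.
[folklore]
-/

noncomputable section

-- `Summit.ValiantsHypothesis.ValiantsHypothesis.…` is the tree's mandated single-conjunct layout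
-- (Sub = Summit), so the duplicated namespace component is intended.
set_option linter.dupNamespace false

namespace Summit.ValiantsHypothesis.ValiantsHypothesis.Theorems.DivisionGap.PerCofactorDegreeReduction.WindowOfRung

/-- Dyadic padding: `m + 3 ≤ 2^(log₂ m + 2)` (from `m < 2^(log₂ m + 1)` and `2 ≤ 2^(log₂ m + 1)`).
[folklore] -/
theorem add_three_le_two_pow_log (m : ℕ) : m + 3 ≤ 2 ^ (Nat.log 2 m + 2) := by
  have h := Nat.lt_pow_succ_log_self one_lt_two m
  have h2 : 2 ≤ 2 ^ (Nat.log 2 m + 1) :=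
    calc 2 = 2 ^ 1 := (pow_one 2).symm
      _ ≤ 2 ^ (Nat.log 2 m + 1) := Nat.pow_le_pow_right two_pos (by omega)
  have h4 : 2 ^ (Nat.log 2 m + 2) = 2 * 2 ^ (Nat.log 2 m + 1) := by
    rw [pow_succ]; ring
  omega

/-- **Window of a rung.**  For every `k` there are `c, n₀` such that for all `n ≥ n₀` and all `s`,
the closed-form rung `⌊n/3⌋ · (2^(⌊n/3⌋ - 1) - 1) ≤ 2 · ((n + 2) · (s + 3))^k` forces the window
bound `n ≤ (log₂ n + log₂ s + c)^c` (witnesses `c := 3k + 3`, `n₀ := 6`). [folklore] -/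
theorem stub_windowOfRung :
    ∀ k : ℕ, ∃ c n₀ : ℕ, ∀ n ≥ n₀, ∀ s : ℕ,
      (n / 3) * (2 ^ (n / 3 - 1) - 1) ≤ 2 * ((n + 2) * (s + 3)) ^ k →
      n ≤ (Nat.log 2 n + Nat.log 2 s + c) ^ c := by
  intro k
  refine ⟨3 * k + 3, 6, fun n hn s hs => ?_⟩
  -- dyadic padding of the two factors
  have hn2 : n + 2 ≤ 2 ^ (Nat.log 2 n + 2) := by
    have := add_three_le_two_pow_log n
    omega
  have hs3 : s + 3 ≤ 2 ^ (Nat.log 2 s + 2) := add_three_le_two_pow_log s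
  have hprod : ((n + 2) * (s + 3)) ^ k ≤ 2 ^ ((Nat.log 2 n + Nat.log 2 s + 4) * k) :=
    calc ((n + 2) * (s + 3)) ^ k ≤ (2 ^ (Nat.log 2 n + 2) * 2 ^ (Nat.log 2 s + 2)) ^ k :=
          Nat.pow_le_pow_left (Nat.mul_le_mul hn2 hs3) k
      _ = 2 ^ ((Nat.log 2 n + Nat.log 2 s + 4) * k) := by
          rw [← pow_add, ← pow_mul]
          congr 1
          ring
  -- the rung, with `q := n / 3 ≥ 2`
  have hq2 : 2 ≤ n / 3 := by omega
  have hmain : 2 ^ (n / 3 - 1) - 1 ≤ 2 * 2 ^ ((Nat.log 2 n + Nat.log 2 s + 4) * k) :=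
    calc 2 ^ (n / 3 - 1) - 1 ≤ (n / 3) * (2 ^ (n / 3 - 1) - 1) :=
          Nat.le_mul_of_pos_left _ (by omega)
      _ ≤ 2 * ((n + 2) * (s + 3)) ^ k := hs
      _ ≤ 2 * 2 ^ ((Nat.log 2 n + Nat.log 2 s + 4) * k) := Nat.mul_le_mul_left 2 hprod
  have hlt : 2 ^ (n / 3 - 1) < 2 ^ ((Nat.log 2 n + Nat.log 2 s + 4) * k + 2) := by
    have h1 : 1 ≤ 2 ^ ((Nat.log 2 n + Nat.log 2 s + 4) * k) := Nat.one_le_two_pow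
    have h4 : 2 ^ ((Nat.log 2 n + Nat.log 2 s + 4) * k + 2) =
        4 * 2 ^ ((Nat.log 2 n + Nat.log 2 s + 4) * k) := by
      rw [pow_add]; ring
    omega
  have hq : n / 3 - 1 < (Nat.log 2 n + Nat.log 2 s + 4) * k + 2 :=
    (Nat.pow_lt_pow_iff_right (by norm_num)).mp hlt
  -- linear-in-`q` consequence
  have hn_le : n ≤ 3 * ((Nat.log 2 n + Nat.log 2 s + 4) * k) + 8 := by omega
  -- the window
  have hc1 : 1 ≤ Nat.log 2 n + Nat.log 2 s + (3 * k + 3) := by omega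
  calc n ≤ 3 * ((Nat.log 2 n + Nat.log 2 s + 4) * k) + 8 := hn_le
    _ ≤ (Nat.log 2 n + Nat.log 2 s + (3 * k + 3)) ^ 2 := by
        nlinarith [Nat.zero_le (Nat.log 2 n + Nat.log 2 s), Nat.zero_le k]
    _ ≤ (Nat.log 2 n + Nat.log 2 s + (3 * k + 3)) ^ (3 * k + 3) :=
        Nat.pow_le_pow_right hc1 (by omega)

end Summit.ValiantsHypothesis.ValiantsHypothesis.Theorems.DivisionGap.PerCofactorDegreeReduction.WindowOfRung

end
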